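import Literature.NumberTheory.QuadraticFields.FundamentalDiscriminant
import HarnessLib

/-!
# Fundamental discriminants: not rational squares, and rigid inside their square class under `d² ∣ D³`

Topic `NumberTheory/QuadraticFields`, namespace `Literature.NumberTheory.QuadraticFields.Quadratic`
(continuing `FundamentalDiscriminant.lean`, whose spelling of "fundamental discriminant" —
`(D % 4 = 1 ∧ Squarefree D ∧ D ≠ 1) ∨ (4 ∣ D ∧ (D/4 % 4 = 2 ∨ D/4 % 4 = 3) ∧ Squarefree (D/4))` —
is used verbatim).  Everything here is PROVED (theorems only; no definition, no named fact).
Two elementary lemmas used in the identification `d_{K₃} = d_{K₂}` of the discriminant of a cubic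
field with that of its quadratic resolvent when the Galois closure is unramified over the
resolvent (Hasse 1930; the arithmetic input of `CubicFields.threeTorsion_eq_two_mul_cubicFieldCountOfDisc_add_one`):

* `ne_sq_of_isFundamental` — a fundamental discriminant is not the square of a rational number
  (so `√D ∉ ℚ`, and a cubic field of fundamental discriminant is not cyclic);
* `eq_of_isFundamental_of_eq_mul_sq_of_sq_dvd_pow_three` — if `D` is fundamental, `d ≡ 0, 1 (mod 4)`
  (Stickelberger), `D = d q²` for a rational `q`, and `d² ∣ D³`, then `d = D`.  (Clearing
  denominators `D b² = d a²`, `(a,b) = 1`: `b⁴ ∣ D` forces `b = 1`, `a² ∣ D` forces `a² ∈ {1,4}`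
  (`sq_eq_one_or_four_of_sq_dvd`), and `D = 4d` would make `d = D/4 ≡ 2, 3 (mod 4)`.)

## References

* D. A. Marcus, *Number Fields*, 2nd ed. (2018), Ch. 2, Thm. 1 and Exercises (fundamental
  discriminants). [Marcus2018]
* H. Hasse, Math. Z. 31 (1930) 565–582 (context: `d_{K₃} = d_{K₂} f²`).
-/

noncomputable section

namespace Literature.NumberTheory.QuadraticFields.Quadratic

/-- A fundamental discriminant is nonzero. [folklore] -/
theorem ne_zero_of_isFundamental {D : ℤ}
    (hD : (D % 4 = 1 ∧ Squarefree D ∧ D ≠ 1) ∨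
      (4 ∣ D ∧ (D / 4 % 4 = 2 ∨ D / 4 % 4 = 3) ∧ Squarefree (D / 4))) : D ≠ 0 := by
  rintro rfl
  rcases hD with ⟨h, -, -⟩ | ⟨-, h, -⟩ <;> omega

/-- **A fundamental discriminant is not a rational square.**  (Clearing denominators in `D = r²`
gives `D b² = a²` with `(a, b) = 1`, so `b = 1` and `D = a²`; but a square dividing a fundamental
discriminant is `1` or `4`, and neither `1` nor `4` is fundamental.) [folklore] -/
theorem ne_sq_of_isFundamental {D : ℤ}
    (hD : (D % 4 = 1 ∧ Squarefree D ∧ D ≠ 1) ∨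
      (4 ∣ D ∧ (D / 4 % 4 = 2 ∨ D / 4 % 4 = 3) ∧ Squarefree (D / 4)))
    (r : ℚ) : (D : ℚ) ≠ r ^ 2 := by
  intro hr
  -- clear denominators: `D den² = num²`
  have key' : (D : ℚ) * (r.den : ℚ) ^ 2 = (r.num : ℚ) ^ 2 := by
    rw [hr, ← Rat.mul_den_eq_num]
    ring
  have key : D * (r.den : ℤ) ^ 2 = r.num ^ 2 := by exact_mod_cast key'
  have hcop : IsCoprime r.num (r.den : ℤ) :=
    Int.isCoprime_iff_nat_coprime.mpr (by simpa using r.reduced)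
  -- `den² ∣ num²`, so `den = 1`
  have hden : (r.den : ℤ) ^ 2 ∣ r.num ^ 2 := ⟨D, by rw [← key]; ring⟩
  have hden1 : IsUnit ((r.den : ℤ) ^ 2) :=
    (hcop.pow (m := 2) (n := 2)).isUnit_of_dvd' hden (dvd_refl _)
  have hden1' : (r.den : ℤ) ^ 2 = 1 := by
    rcases Int.isUnit_iff.mp hden1 with h | h
    · exact h
    · nlinarith [sq_nonneg (r.den : ℤ)]
  rw [hden1', mul_one] at key
  -- `num² ∣ D`, so `num² ∈ {1, 4}`, i.e. `D ∈ {1, 4}`: not fundamental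
  have hsq : r.num ^ 2 ∣ D := ⟨1, by rw [key, mul_one]⟩
  rcases sq_eq_one_or_four_of_sq_dvd hD hsq with h1 | h4
  · rw [h1] at key
    rcases hD with ⟨-, -, hne⟩ | ⟨h4', -, -⟩
    · exact hne key
    · omega
  · rw [h4] at key
    rcases hD with ⟨h1', -, -⟩ | ⟨-, hm, -⟩ <;> omega

/-- **Rigidity in the square class under `d² ∣ D³`.**  Let `D` be a fundamental discriminant and
`d ≡ 0` or `1 (mod 4)` an integer with `D = d q²` for some rational `q` and `d² ∣ D³`.  Then
`d = D`.  (In the application `d = d_{K₃}` is the discriminant of a cubic field — `≡ 0, 1 (mod 4)`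
by Stickelberger — whose quadratic resolvent field has discriminant `D`, and `d² ∣ D³` comes from
the discriminant towers of the unramified sextic closure.) [folklore] -/
theorem eq_of_isFundamental_of_eq_mul_sq_of_sq_dvd_pow_three {D d : ℤ}
    (hD : (D % 4 = 1 ∧ Squarefree D ∧ D ≠ 1) ∨
      (4 ∣ D ∧ (D / 4 % 4 = 2 ∨ D / 4 % 4 = 3) ∧ Squarefree (D / 4)))
    (hd4 : d % 4 = 0 ∨ d % 4 = 1) {q : ℚ} (hq : (D : ℚ) = d * q ^ 2) (hdvd : d ^ 2 ∣ D ^ 3) :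
    d = D := by
  have hD0 : D ≠ 0 := ne_zero_of_isFundamental hD
  -- clear denominators: `D den² = d num²`
  have key' : (D : ℚ) * (q.den : ℚ) ^ 2 = d * (q.num : ℚ) ^ 2 := by
    rw [hq, ← Rat.mul_den_eq_num]
    ring
  have key : D * (q.den : ℤ) ^ 2 = d * q.num ^ 2 := by exact_mod_cast key'
  have hcop : IsCoprime q.num (q.den : ℤ) :=
    Int.isCoprime_iff_nat_coprime.mpr (by simpa using q.reduced)
  -- `den⁴ ∣ D num⁴` (from `d² ∣ D³`), hence `den⁴ ∣ D`, hence `den = 1`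
  have h4dvd : ((q.den : ℤ) ^ 2) ^ 2 ∣ D := by
    have h1 : D ^ 2 * (q.den : ℤ) ^ 4 = d ^ 2 * q.num ^ 4 := by
      have := congrArg (· ^ 2) key
      simpa [mul_pow, ← pow_mul] using this
    -- `d² num⁴ ∣ D³ num⁴`, i.e. `D² den⁴ ∣ D³ num⁴`, so `den⁴ ∣ D num⁴`
    have h2 : D ^ 2 * (q.den : ℤ) ^ 4 ∣ D ^ 2 * (D * q.num ^ 4) := by
      rw [h1, show D ^ 2 * (D * q.num ^ 4) = D ^ 3 * q.num ^ 4 by ring]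
      exact mul_dvd_mul_right hdvd _
    have h3 : (q.den : ℤ) ^ 4 ∣ D * q.num ^ 4 :=
      (mul_dvd_mul_iff_left (pow_ne_zero 2 hD0)).mp h2
    have h5 : (q.den : ℤ) ^ 4 ∣ D := (hcop.symm.pow (m := 4) (n := 4)).dvd_of_dvd_mul_right h3
    rwa [show ((q.den : ℤ) ^ 2) ^ 2 = (q.den : ℤ) ^ 4 by ring]
  have hden1 : (q.den : ℤ) = 1 := by
    rcases sq_eq_one_or_four_of_sq_dvd hD h4dvd with h | h
    · have hpos : 0 < (q.den : ℤ) := by exact_mod_cast q.den_pos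
      nlinarith [sq_nonneg ((q.den : ℤ) - 1), sq_nonneg ((q.den : ℤ) + 1)]
    · -- `(den²)² = 4` forces `den² = 2`: impossible
      exfalso
      have hpos : 0 < (q.den : ℤ) := by exact_mod_cast q.den_pos
      have hsq : (q.den : ℤ) ^ 2 = 2 := by nlinarith [sq_nonneg (q.den : ℤ)]
      have h1 : (q.den : ℤ) ≠ 1 := by
        intro h1
        rw [h1] at hsq
        norm_num at hsq
      have h2 : 2 ≤ (q.den : ℤ) := by omega
      nlinarith
  rw [hden1, one_pow, mul_one] at key
  -- now `D = d num²` with `num² ∣ D`, so `num² ∈ {1, 4}`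
  have hsq : q.num ^ 2 ∣ D := ⟨d, by rw [key, mul_comm]⟩
  rcases sq_eq_one_or_four_of_sq_dvd hD hsq with h1 | h4
  · rw [h1, mul_one] at key
    exact key.symm
  · -- `D = 4 d`: then `d = D / 4 ≡ 2, 3 (mod 4)`, contradicting `d ≡ 0, 1 (mod 4)`
    exfalso
    rw [h4] at key
    rcases hD with ⟨h1', -, -⟩ | ⟨-, hm, -⟩
    · omega
    · have : D / 4 = d := by omega
      rw [this] at hm
      omega

end Literature.NumberTheory.QuadraticFields.Quadratic

end
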